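import Summits.BirchSwinnertonDyer.Rank1Residual.Supersingular.KuriharaLevelOneFunctionalEquation
import HarnessLib

/-!
# The level-one Kurihara functional equation at a prime-power modulus: Kim's Prop. 3.16 (`ν = 1`) and its `p = 2` shadow
# (cell `b2b-bsdres`, O1 sub-cell `p = 2`; typer item (26b), part 2; cc-typer-4 GEN 6)

HONEST FRAMING (run/shared/lean/b2b/bsd-rank1-residual/, verbatim in every file): the goal of the cell is to DELETE
the COMBINATION-SHAPED residual classes of the Birch–Swinnerton-Dyer formula for ALL analytic-rank `≤ 1` elliptic
curves over `ℚ` — "full BSD formula for every rank `≤ 1` curve in class `C`" assembled STRICTLY from published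
theorems — so that the rank-`≤ 1` remainder becomes exactly the CONSTRUCTION-SHAPED classes, which are TYPED
(missing-input `Prop`s), NOT attempted. This is not "finishing BSD". THEOREMS only (no `def`, no named fact; nothing
asserted about a particular curve; nothing booked; no RESIDUAL-MAP mark moves).

Part 1 (`Supersingular/KuriharaLevelOneFunctionalEquation.lean`) proves, for `f ∈ S₂(Γ₀(N))` with
`f(−1/(Nτ)) = −σ N τ² f(τ)`, a prime `ℓ ∤ N`, ANY modulus `m` and ANY `ψ : (ℤ/ℓ)ˣ → ℤ/m`:
`(1 + σ)·δ_ℓ(ψ) = σ·(ψ(−1) − ψ(N))·S̄_ℓ`, `S̄_ℓ = Σ_{a ∈ (ℤ/ℓ)ˣ} \overline{[a/ℓ]⁺}`, and (Hecke) `Σ_a [a/ℓ]⁺ = (a_ℓ(E) − 2)·[0]⁺`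
for the newform of `E` at a good `ℓ`. Here, at `m = p^k` and under `p`-INTEGRALITY of the symbols `[a/ℓ]⁺`, `a ∈ ℤ/ℓ`
(hypothesis `hint`; for `E[p]` irreducible and odd `p` the tree's `IsNewformOf.norm_ratPlusSymbol_le_one` discharges it,
at `p = 2` it is a genuine per-curve datum — symbols can be half-integral): `ratModP (p^k)` is additive on
`p`-integral rationals (§1, via `ratModP_eq_toZModPow`), so `S̄_ℓ = (a_ℓ − 2)·\overline{[0]⁺}` (§2) and
* (i) ODD `p`, `w(E) = +1`, `a_ℓ ≡ 2 (mod p^k)` (a Kolyvagin prime: `ℓ ≡ 1`, `a_ℓ ≡ ℓ + 1`): **`δ_ℓ = 0` in `ℤ/p^k`** —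
  Kim 2022, Prop. 3.16 for `ν(n) = 1` ("if `(−1)^{ν(n)} ≠ w(E)` then `δ̃_n = 0`") as a THEOREM of the tree
  (`kuriharaNumber_prime_eq_zero_of_odd`);
* (ii) `p = 2`, `w(E) = +1`, `a_ℓ` EVEN: **`2·δ_ℓ = −(a_ℓ − 2)·\overline{[0]⁺}·ψ(N)` in `ℤ/2^k`**
  (`two_mul_kuriharaNumber_prime_eq_neg`) — lens-4's 4.36 (b) "`2·D(ℓ) ≡ −(a_ℓ − 2)·x(0)·Log_η(N) (mod 2^{v₂(ℓ−1)})`"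
  (`cells/o1/ROUTES-O1.md` §4.36; census 4 935 / 4 935 on KUR2X-v2, EVIDENCE, not used; `a_ℓ` is even at their
  admissible `ℓ`, `Frob_ℓ` a transposition on `E[2]`): the term `ψ(−1)·S̄` of the functional equation dies because
  `2·ψ(−1) = ψ(1) = 0` and `S̄` is even; so a level-one Kurihara number of a rank-zero curve is determined
  `mod 2^{k−1}` by `[0]⁺`, `a_ℓ`, `ψ(N)` — it carries NO information on `#Ш` beyond `[0]⁺` (lens-4's ORDER question,
  closed negatively); and at a Kim-admissible `ℓ` (`a_ℓ ≡ 2 (mod 2^k)`) **`2·δ_ℓ = 0`** (`two_mul_kuriharaNumber_prime_eq_zero`):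
  at `p = 2` "−δ = δ" is `2`-torsion, not vanishing.

References: C.-H. Kim, arXiv:2203.12159 (Amer. J. Math.), §3.5, Prop. 3.16; B. Mazur, J. Tate, Duke Math. J. 54 (1987),
§1; K. Ota, Amer. J. Math. 140 (2018), Prop. 5.16; M. Kurihara, Iwasawa Theory 2012 (2014), §1.1.
-/

set_option autoImplicit false

noncomputable section

open scoped Classical MatrixGroups ModularForm

open CongruenceSubgroup Literature.NumberTheory.EllipticCurves Literature.NumberTheory.EllipticCurves.ModularForms
open Literature.NumberTheory.DiophantineGeometry.Dioph (ratModP)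

namespace Summit.BirchSwinnertonDyer.Rank1Residual.Supersingular

/-! ## §1–§2. `ratModP (p^k)` on `p`-integral rationals; `S̄_ℓ = (a_ℓ − 2)·\overline{[0]⁺}`; the consequences -/

section PrimePower

open KuriharaTwist.Identity

variable {N : ℕ} [NeZero N] {f : CuspForm (Gamma0 N) 2} {p : ℕ} [hp : Fact p.Prime] (k : ℕ)
  {W : WeierstrassCurve ℚ} [W.IsElliptic] [W.IsGloballyMinimal]

/-- `ratModP (p^k)` is additive on `p`-integral rationals (both are `toZModPow k` of `p`-adic integers). [folklore] -/
theorem ratModP_pow_add {x y : ℚ} (hx : ‖(x : ℚ_[p])‖ ≤ 1) (hy : ‖(y : ℚ_[p])‖ ≤ 1) :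
    ratModP (p ^ k) (x + y) = ratModP (p ^ k) x + ratModP (p ^ k) y := by
  have hxy : ‖((x + y : ℚ) : ℚ_[p])‖ ≤ 1 := by
    rw [Rat.cast_add]; exact (IsUltrametricDist.norm_add_le_max _ _).trans (max_le hx hy)
  rw [ratModP_eq_toZModPow p k (not_dvd_den_of_norm_ratCast_le_one hx),
    ratModP_eq_toZModPow p k (not_dvd_den_of_norm_ratCast_le_one hy),
    ratModP_eq_toZModPow p k (not_dvd_den_of_norm_ratCast_le_one hxy), ← map_add]
  congr 1

/-- `ratModP (p^k)` of a finite sum of `p`-integral rationals. [folklore] -/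
theorem ratModP_pow_sum {ι : Type*} (s : Finset ι) {g : ι → ℚ} (hg : ∀ i ∈ s, ‖(g i : ℚ_[p])‖ ≤ 1) :
    ratModP (p ^ k) (∑ i ∈ s, g i) = ∑ i ∈ s, ratModP (p ^ k) (g i) := by
  induction s using Finset.cons_induction with
  | empty => simp
  | cons a s ha ih =>
    rw [Finset.sum_cons, Finset.sum_cons]
    have hs : ∀ i ∈ s, ‖(g i : ℚ_[p])‖ ≤ 1 := fun i hi => hg i (Finset.mem_cons_of_mem hi)
    have hsum : ‖((∑ i ∈ s, g i : ℚ) : ℚ_[p])‖ ≤ 1 := by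
      rw [Rat.cast_sum]
      exact IsUltrametricDist.norm_sum_le_of_forall_le_of_nonneg zero_le_one hs
    rw [ratModP_pow_add k (hg a (Finset.mem_cons_self a s)) hsum, ih hs]

/-- `ratModP (p^k) (z · x) = z · ratModP (p^k) x` for an integer `z` and `p`-integral `x`. [folklore] -/
theorem ratModP_pow_intCast_mul (z : ℤ) {x : ℚ} (hx : ‖(x : ℚ_[p])‖ ≤ 1) :
    ratModP (p ^ k) (z * x) = (z : ZMod (p ^ k)) * ratModP (p ^ k) x := by
  have hz : ‖((z : ℚ) : ℚ_[p])‖ ≤ 1 := by rw [Rat.cast_intCast]; exact Padic.norm_int_le_one z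
  have hzx : ‖((z * x : ℚ) : ℚ_[p])‖ ≤ 1 := by
    rw [Rat.cast_mul, norm_mul]; exact mul_le_one₀ hz (norm_nonneg _) hx
  rw [ratModP_eq_toZModPow p k (not_dvd_den_of_norm_ratCast_le_one hx),
    ratModP_eq_toZModPow p k (not_dvd_den_of_norm_ratCast_le_one hzx)]
  set X : ℤ_[p] := ⟨(x : ℚ_[p]), Padic.norm_rat_le_one (not_dvd_den_of_norm_ratCast_le_one hx)⟩ with hX
  set ZX : ℤ_[p] := ⟨((z * x : ℚ) : ℚ_[p]), Padic.norm_rat_le_one (not_dvd_den_of_norm_ratCast_le_one hzx)⟩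
    with hZX
  have : ZX = (z : ℤ_[p]) * X := PadicInt.ext (by rw [hZX, hX]; push_cast; rfl)
  rw [this, map_mul, map_intCast]

/-- **`S̄_ℓ = (a_ℓ − 2)·\overline{[0]⁺}` in `ℤ/p^k`** when the symbols `[a/ℓ]⁺_f`, `a ∈ ℤ/ℓ`, are `p`-integral.
[folklore] -/
theorem sum_units_ratModP_ratPlusSymbol_div_eq (hf : IsNewformOf W f) {ℓ : ℕ} [hℓ : Fact ℓ.Prime]
    (hgood : W.HasGoodReductionAtPrime ℓ)
    (hint : ∀ a : ZMod ℓ, ‖(ratPlusSymbol f (((a.val : ℕ) : ℚ) / (ℓ : ℚ)) : ℚ_[p])‖ ≤ 1) :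
    ∑ a : (ZMod ℓ)ˣ, ratModP (p ^ k) (ratPlusSymbol f ((((a : ZMod ℓ).val : ℕ) : ℚ) / (ℓ : ℚ))) =
      ((W.frobeniusTrace ℓ - 2 : ℤ) : ZMod (p ^ k)) * ratModP (p ^ k) (ratPlusSymbol f 0) := by
  have h0 : ‖(ratPlusSymbol f 0 : ℚ_[p])‖ ≤ 1 := by
    simpa [ZMod.val_zero] using hint 0
  rw [← ratModP_pow_sum k (Finset.univ : Finset (ZMod ℓ)ˣ)
      (g := fun a => ratPlusSymbol f ((((a : ZMod ℓ).val : ℕ) : ℚ) / (ℓ : ℚ))) (fun a _ => hint (a : ZMod ℓ)),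
    sum_units_ratPlusSymbol_div_eq hf hgood, ← ratModP_pow_intCast_mul k _ h0]
  push_cast
  ring_nf

/-- **Kim's Prop. 3.16 for `ν(n) = 1`, as a THEOREM (odd `p`)**: for the newform of `E` with `w(E) = +1`
(`f(−1/(Nτ)) = −N τ² f(τ)`), an odd prime `p`, a good prime `ℓ ∤ pN` with `a_ℓ(E) ≡ 2 (mod p^k)` (e.g. a Kolyvagin
prime: `ℓ ≡ 1`, `a_ℓ ≡ ℓ + 1 (mod p^k)`) and `p`-integral symbols: **`δ_ℓ = 0` in `ℤ/p^k`** for every `ψ`.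
[cite: Kim2022StructureSelmer, Prop. 3.16 (PDF p. 19)] -/
theorem kuriharaNumber_prime_eq_zero_of_odd (hf : IsNewformOf W f) (hW : IsFrickeEigen N f (-(1 : ℂ)))
    (hp2 : p ≠ 2) {ℓ : ℕ} [hℓ : Fact ℓ.Prime] (hgood : W.HasGoodReductionAtPrime ℓ) (hℓN : ¬ ℓ ∣ N)
    (haℓ : ((W.frobeniusTrace ℓ : ℤ) : ZMod (p ^ k)) = 2)
    (hint : ∀ a : ZMod ℓ, ‖(ratPlusSymbol f (((a.val : ℕ) : ℚ) / (ℓ : ℚ)) : ℚ_[p])‖ ≤ 1)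
    (ψ : (q : ℕ) → (ZMod q)ˣ →* Multiplicative (ZMod (p ^ k))) :
    kuriharaNumber f (p ^ k) ℓ ψ = 0 := by
  have h := two_mul_kuriharaNumber_prime_eq f (p ^ k) hW hℓN ψ
  rw [sum_units_ratModP_ratPlusSymbol_div_eq k hf hgood hint, Int.cast_sub, haℓ] at h
  norm_num at h
  -- `2` is a unit mod `p^k` for odd `p`
  have hpodd : Odd p := by
    rcases hp.out.eq_two_or_odd' with h2 | hodd
    · exact absurd h2 hp2
    · exact hodd
  have h2 : IsUnit (2 : ZMod (p ^ k)) := by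
    rw [show (2 : ZMod (p ^ k)) = ((2 : ℕ) : ZMod (p ^ k)) by norm_num, ZMod.isUnit_iff_coprime]
    exact (Nat.coprime_two_left.mpr hpodd).pow_right k
  exact (h2.mul_right_eq_zero).mp h

/-- **At `p = 2`, `w(E) = +1`, `a_ℓ` even and `2`-integral symbols: `2·δ_ℓ = −(a_ℓ − 2)·\overline{[0]⁺}·ψ(N)` in
`ℤ/2^k`** — lens-4's 4.36 (b) "`2·D(ℓ) ≡ −(a_ℓ − 2)·x(0)·Log_η(N) (mod 2^{v₂(ℓ−1)})`" (census 4 935 / 4 935, EVIDENCE):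
the term `ψ(−1)·S̄` of the functional equation dies because `2·ψ(−1) = ψ(1) = 0` and `S̄ = (a_ℓ − 2)·\overline{[0]⁺}` is
EVEN. [cite: MazurTate1987, §1] -/
theorem two_mul_kuriharaNumber_prime_eq_neg (hf : IsNewformOf W f) (hW : IsFrickeEigen N f (-(1 : ℂ)))
    {ℓ : ℕ} [hℓ : Fact ℓ.Prime] (hgood : W.HasGoodReductionAtPrime ℓ) (hℓN : ¬ ℓ ∣ N)
    (heven : Even (W.frobeniusTrace ℓ))
    (hint : ∀ a : ZMod ℓ, ‖(ratPlusSymbol f (((a.val : ℕ) : ℚ) / (ℓ : ℚ)) : ℚ_[2])‖ ≤ 1)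
    (ψ : (q : ℕ) → (ZMod q)ˣ →* Multiplicative (ZMod (2 ^ k))) :
    (2 : ZMod (2 ^ k)) * kuriharaNumber f (2 ^ k) ℓ ψ =
      -(((W.frobeniusTrace ℓ - 2 : ℤ) : ZMod (2 ^ k)) * ratModP (2 ^ k) (ratPlusSymbol f 0) *
        Multiplicative.toAdd (ψ ℓ (ZMod.unitOfCoprime N ((Nat.coprime_comm).mp
          ((Nat.Prime.coprime_iff_not_dvd hℓ.out).mpr hℓN))))) := by
  haveI : Fact (Nat.Prime 2) := ⟨Nat.prime_two⟩
  have h := two_mul_kuriharaNumber_prime_eq f (2 ^ k) hW hℓN ψ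
  rw [sum_units_ratModP_ratPlusSymbol_div_eq k hf hgood hint] at h
  -- `2·ψ(−1) = 0`
  have hm1 : (2 : ZMod (2 ^ k)) * Multiplicative.toAdd (ψ ℓ (-1)) = 0 := by
    rw [two_mul, ← toAdd_mul, ← map_mul, neg_one_mul, neg_neg, map_one, toAdd_one]
  -- `a_ℓ − 2 = 2t`
  obtain ⟨t, ht⟩ : ∃ t : ℤ, W.frobeniusTrace ℓ - 2 = 2 * t := by
    obtain ⟨r, hr⟩ := heven; exact ⟨r - 1, by omega⟩
  rw [h, ht]
  push_cast
  linear_combination (↑t * ratModP (2 ^ k) (ratPlusSymbol f 0)) * hm1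

/-- **At `p = 2` and a Kim-admissible `ℓ` (`a_ℓ ≡ 2 (mod 2^k)`), `w(E) = +1`: `2·δ_ℓ = 0` in `ℤ/2^k`** — the `p = 2`
shadow of Prop. 3.16 ("−δ = δ" is `2`-torsion, not vanishing). [cite: Kim2022StructureSelmer, Prop. 3.16 (PDF p. 19)] -/
theorem two_mul_kuriharaNumber_prime_eq_zero (hf : IsNewformOf W f) (hW : IsFrickeEigen N f (-(1 : ℂ)))
    {ℓ : ℕ} [hℓ : Fact ℓ.Prime] (hgood : W.HasGoodReductionAtPrime ℓ) (hℓN : ¬ ℓ ∣ N)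
    (haℓ : ((W.frobeniusTrace ℓ : ℤ) : ZMod (2 ^ k)) = 2)
    (hint : ∀ a : ZMod ℓ, ‖(ratPlusSymbol f (((a.val : ℕ) : ℚ) / (ℓ : ℚ)) : ℚ_[2])‖ ≤ 1)
    (ψ : (q : ℕ) → (ZMod q)ˣ →* Multiplicative (ZMod (2 ^ k))) :
    (2 : ZMod (2 ^ k)) * kuriharaNumber f (2 ^ k) ℓ ψ = 0 := by
  haveI : Fact (Nat.Prime 2) := ⟨Nat.prime_two⟩
  have h := two_mul_kuriharaNumber_prime_eq f (2 ^ k) hW hℓN ψ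
  rw [sum_units_ratModP_ratPlusSymbol_div_eq k hf hgood hint, Int.cast_sub, haℓ] at h
  norm_num at h
  exact h

end PrimePower

end Summit.BirchSwinnertonDyer.Rank1Residual.Supersingular

end
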